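import Mathlib
import Literature.Analysis.FluidPDE.LocalTypeIBlowup.SingularVertexZoom
import Literature.Analysis.FluidPDE.TypeIRateOseenMildRepresentative
import Literature.Analysis.FluidPDE.LocalTypeICongr
import Literature.Analysis.FluidPDE.SuitableWeakCongr
import Literature.Analysis.FluidPDE.LocalTypeIReverseTools
import Summits.NavierStokesRegularity.NavierStokesRegularity.Theorems.RellichScarTypeIBlowupProfile
import Summits.NavierStokesRegularity.NavierStokesRegularity.Theses.MeanFieldTypeI
import HarnessLib

/-!
# `MeanFieldTypeI.TypeIBlowupGivesAncient` (item stmt-NavierStokesRegularity-1685), PROVED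

**Statement.** A classical solution `(u, p)` of Navier–Stokes (viscosity `ν > 0`) on `ℝ³ × [0, T)`,
Leray–Hopf from its rapidly decaying datum `u 0`, with NO smooth extension past `T` and the Type-I
rate `‖u(t, x)‖ ≤ C/√(T − t)` near `T`, yields constants `C`, `M < ∞` and a NON-TRIVIAL field `v` of
the class `K(C, M)`: an ancient mild solution of the unit-viscosity system (`IsAncientMildSolution 1`),
jointly smooth on the open backward slab, with the Type-I time rate `HasTypeITimeDecay C v`, which
with some pressure and weak gradient is a suitable weak solution on the slab with Albritton–Barker
quantity `𝐈(ℝ³ × ℝ₋) ≤ M`.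

PROOF (glue of tree theorems; every input kernel-checked).
1. `typeIBlowupProfile_proof` (item stmt-NavierStokesRegularity-1591 of route RellichScar: Morrey
   bound of a Type-I solution, singular point at the maximal time, viscosity-normalising zoom,
   Seregin's zoom-in at the singular vertex, persistence of the singularity): a suitable weak
   solution `(w, q)` of the unit-viscosity system on the backward slab with weak gradient `H`,
   `𝐈 < ∞`, the pointwise rate `‖w(t, x)‖ ≤ C/√(−t)` and a backward-SINGULAR origin.
2. `exists_oseenMild_repr_of_typeIBound_lt_top` (KNSS 2009, Lemma 3.1 with the parasitic drift
   killed by the `A`-part of `𝐈`): `w` has a continuous, weakly divergence-free, Oseen-mild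
   representative `v` with the same rate; `LocalTypeIBlowup.isTypeIAncientMild_of_continuous_oseenMild_rate`
   (KNSS 2009, Prop. 4.1) puts `v` in the tree's class `IsTypeIAncientMild C` (jointly smooth,
   divergence free, Oseen-mild, rate), whence `IsAncientMildSolution 1 v`, `ContDiffOn` and
   `HasTypeITimeDecay C v` are projections.
3. Suitability, the weak gradient and `𝐈` pass from `w` to `v` along the a.e. equality
   (`IsSuitableWeakSolutionOn.congr_ae`, `HasWeakSpatialGradientOn.congr_ae`, `typeIBound_congr_ae`);
   `M := 𝐈(v) < ∞`.
4. Non-triviality: if `v` vanished at every negative time, `w` would vanish a.e. on the unit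
   backward ball `Q(0, 1)`, whose essential supremum is `∞` (singular origin).

HONEST FRAMING: a bookkeeping bridge between two formulations of a HYPOTHETICAL Type-I singularity
(Clay-class blow-up ⇒ a non-trivial element of the Liouville class `K(C, M)`); no such singularity is
asserted to exist, and nothing here bears on the regularity problem itself.

References: D. Albritton, T. Barker, arXiv:1811.00502, Thm. 1.1, Lemma 2.5, Remark 3.2, §3;
G. Koch, N. Nadirashvili, G. Seregin, V. Šverák, Acta Math. 203 (2009), Lemma 3.1, Prop. 4.1, §6;
G. Seregin, V. Šverák, arXiv:0804.1803, Thm. 2.8.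
-/

noncomputable section

set_option linter.dupNamespace false

namespace Summit.NavierStokesRegularity.NavierStokesRegularity.Theorems

open MeasureTheory Set Function Filter Topology TopologicalSpace Metric
open Literature.Analysis.FluidPDE
open scoped NNReal ENNReal

namespace TypeIBlowupGivesAncient

/-- **Clay-class Type-I blow-up generates a non-trivial Type-I ancient mild solution, singular at
the origin.** For `ν, T > 0`, a classical solution `(u, p)` on `ℝ³ × [0, T)`, Leray–Hopf from its
rapidly decaying datum, without smooth extension past `T` and blowing up at the Type-I rate, there
are `C` and a field `v` in the Oseen-gauge Type-I ancient mild class `IsTypeIAncientMild C v`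
(jointly smooth on the open slab, divergence free, Oseen-mild, `‖v(t, x)‖ ≤ C/√(−t)`) which with
some pressure `q` and weak gradient `H` is a suitable weak solution of the unit-viscosity system on
`ℝ³ × ℝ₋` with `𝐈(ℝ³ × ℝ₋) < ∞` and a backward-singular origin. Glue of `typeIBlowupProfile_proof`
(the slab profile), `exists_oseenMild_repr_of_typeIBound_lt_top` (KNSS Lemma 3.1 representative) and
`LocalTypeIBlowup.isTypeIAncientMild_of_continuous_oseenMild_rate` (KNSS Prop. 4.1), with the a.e.
transfer of suitability, gradient, `𝐈` and the singularity.
[cite: AlbrittonBarker2019, Thm. 1.1 (forward direction), Lemma 2.5, Remark 3.2 and §3; KochNadirashviliSereginSverak2009, Lemma 3.1 and Prop. 4.1] -/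
theorem exists_typeIAncientMild_singular_of_isTypeIBlowup {ν T : ℝ} (hν : 0 < ν) (hT : 0 < T)
    {u : ℝ → EuclideanSpace ℝ (Fin 3) → EuclideanSpace ℝ (Fin 3)}
    {p : ℝ → EuclideanSpace ℝ (Fin 3) → ℝ}
    (hsol : IsClassicalNSSolutionOn (Ico 0 T) ν 0 u p) (hLH : IsLerayHopfOn T ν 0 (u 0) u)
    (hdec : HasRapidSpatialDecay (u 0)) (hext : ¬ HasSmoothExtensionPast ν 0 u T)
    (hI : IsTypeIBlowup u T) :
    ∃ (C : ℝ) (v : ℝ → EuclideanSpace ℝ (Fin 3) → EuclideanSpace ℝ (Fin 3))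
      (q : ℝ → EuclideanSpace ℝ (Fin 3) → ℝ)
      (H : ℝ → EuclideanSpace ℝ (Fin 3) → EuclideanSpace ℝ (Fin 3) →L[ℝ] EuclideanSpace ℝ (Fin 3)),
      IsTypeIAncientMild C v ∧
      IsSuitableWeakSolutionOn (slab (EuclideanSpace ℝ (Fin 3)) (Iio 0) isOpen_Iio) 1 0 v q ∧
      HasWeakSpatialGradientOn (slab (EuclideanSpace ℝ (Fin 3)) (Iio 0) isOpen_Iio) v H ∧
      typeIBound (Iio (0 : ℝ) ×ˢ univ) v q H < ⊤ ∧
      IsBackwardSingularPoint v 0 := by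
  -- ## (1) the slab profile of route RellichScar (item 1591)
  obtain ⟨w, q, H, C, hsw, hH, hIw, hrate, hsing⟩ :=
    typeIBlowupProfile_proof ν T hν hT u p ⟨hsol, hext⟩ hLH hdec hI
  -- ## (2) the continuous Oseen-mild representative (KNSS Lemma 3.1) and its class (Prop. 4.1)
  obtain ⟨v, hae, hvc, hvdiv, hvmild, hvrate⟩ := exists_oseenMild_repr_of_typeIBound_lt_top hsw hrate hIw
  have hv : IsTypeIAncientMild C v :=
    LocalTypeIBlowup.isTypeIAncientMild_of_continuous_oseenMild_rate hvc hvdiv hvmild hvrate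
  -- ## (3) transfer along the a.e. equality on the slab
  have hslab : ((slab (EuclideanSpace ℝ (Fin 3)) (Iio 0) isOpen_Iio :
      Opens (ℝ × EuclideanSpace ℝ (Fin 3))) : Set (ℝ × EuclideanSpace ℝ (Fin 3))) =
      Iio (0 : ℝ) ×ˢ (univ : Set (EuclideanSpace ℝ (Fin 3))) := coe_slab _ _
  have hae' : ∀ᵐ z ∂(volume.restrict ((slab (EuclideanSpace ℝ (Fin 3)) (Iio 0) isOpen_Iio :
      Opens (ℝ × EuclideanSpace ℝ (Fin 3))) : Set (ℝ × EuclideanSpace ℝ (Fin 3)))),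
      uncurry w z = uncurry v z := by
    rw [hslab]; exact hae
  have hsw' : IsSuitableWeakSolutionOn (slab (EuclideanSpace ℝ (Fin 3)) (Iio 0) isOpen_Iio) 1 0 v q :=
    hsw.congr_ae hae' (ae_of_all _ fun _ => rfl)
  have hH' : HasWeakSpatialGradientOn (slab (EuclideanSpace ℝ (Fin 3)) (Iio 0) isOpen_Iio) v H :=
    hH.congr_ae hae'
  have hIv : typeIBound (Iio (0 : ℝ) ×ˢ univ) v q H < ⊤ := by
    rw [← typeIBound_congr_ae (p := q) (G := H) hae]; exact hIw
  have hsing' : IsBackwardSingularPoint v 0 :=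
    hsing.congr_ae (S := Iio (0 : ℝ) ×ˢ (univ : Set (EuclideanSpace ℝ (Fin 3))))
      (fun r _ => parabolicCylinder_subset_lowerHalf le_rfl r) hae
  exact ⟨C, v, q, H, hv, hsw', hH', hIv, hsing'⟩

/-- A field vanishing at every negative time is not backward-singular at the origin: the unit
backward ball `Q(0, 1)` lies in `ℝ³ × ℝ₋`, so the essential supremum of the field over it is `0`,
not `∞`. [folklore] -/
theorem not_isBackwardSingularPoint_of_forall_eq_zero
    {v : ℝ → EuclideanSpace ℝ (Fin 3) → EuclideanSpace ℝ (Fin 3)}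
    (h0 : ∀ t < (0 : ℝ), ∀ x, v t x = 0) : ¬ IsBackwardSingularPoint v 0 := by
  intro hsing
  have hzero : ∀ᵐ z ∂(volume.restrict (parabolicCylinder 1 (0 : ℝ × EuclideanSpace ℝ (Fin 3)))),
      uncurry v z = (0 : ℝ × EuclideanSpace ℝ (Fin 3) → EuclideanSpace ℝ (Fin 3)) z := by
    filter_upwards [ae_restrict_mem (isOpen_parabolicCylinder (1 : ℝ)
      (0 : ℝ × EuclideanSpace ℝ (Fin 3))).measurableSet] with z hz
    have hz1 : z.1 < 0 := (parabolicCylinder_subset_lowerHalf le_rfl 1 hz).1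
    exact h0 z.1 hz1 z.2
  have h := hsing 1 one_pos
  rw [eLpNorm_congr_ae hzero, eLpNorm_zero] at h
  exact ENNReal.zero_ne_top h

end TypeIBlowupGivesAncient

open TypeIBlowupGivesAncient in
/-- **Item stmt-NavierStokesRegularity-1685** (`MeanFieldTypeI.TypeIBlowupGivesAncient`): Type-I
blow-up of a classical Leray–Hopf solution from a rapidly decaying datum without smooth extension
past `T` gives a NON-TRIVIAL element of `K(C, M)` — an ancient mild solution of the unit-viscosity
system, jointly smooth on the open backward slab, with the Type-I time rate `C`, suitable with a
pressure and a weak gradient on the slab with `𝐈(ℝ³ × ℝ₋) ≤ M < ∞` (here `M := 𝐈` itself).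
Projections of `exists_typeIAncientMild_singular_of_isTypeIBlowup`; non-triviality from the
singular origin (`not_isBackwardSingularPoint_of_forall_eq_zero`).
[cite: AlbrittonBarker2019, Thm. 1.1 (forward direction), Lemma 2.5 and Remark 3.2; KochNadirashviliSereginSverak2009, Prop. 4.1 and §6] -/
theorem meanFieldTypeI_typeIBlowupGivesAncient_proof :
    Summit.NavierStokesRegularity.NavierStokesRegularity.Theses.MeanFieldTypeI.TypeIBlowupGivesAncient := by
  unfold Summit.NavierStokesRegularity.NavierStokesRegularity.Theses.MeanFieldTypeI.TypeIBlowupGivesAncient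
  intro ν T hν hT u p hsol hLH hdec hext hI
  obtain ⟨C, v, q, H, hv, hsw, hH, hIv, hsing⟩ :=
    exists_typeIAncientMild_singular_of_isTypeIBlowup hν hT hsol hLH hdec hext hI
  refine ⟨C, typeIBound (Iio (0 : ℝ) ×ˢ univ) v q H, v, hIv,
    ⟨hv.isAncientMildSolution, hv.contDiffOn, hv.hasTypeITimeDecay, q, H, hsw, hH, le_rfl⟩, ?_⟩
  exact fun h0 => not_isBackwardSingularPoint_of_forall_eq_zero h0 hsing

end Summit.NavierStokesRegularity.NavierStokesRegularity.Theorems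

end
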